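import Mathlib.Data.Fin.Basic
import Mathlib.Data.Nat.Basic
import Mathlib.Order.Basic
import Mathlib.Tactic.FinCases
import Mathlib.Tactic.NormNum
import Mathlib.Algebra.BigOperators.Fin
import Mathlib.Algebra.Order.Field.Rat
import HarnessLib

/-!
# Splitting `Fin`-indexed certificate checks into blocks (one `decide +kernel` per block)

Compute-infrastructure file (unit `infra-psd-sos-lp-checker`). The certificate predicates of
`Certificates/{LinearProgramming,PosSemidef,…}.lean` are conjunctions of statements
`∀ i : Fin n, P i` with decidable `P`. A single `decide +kernel` evaluates the whole conjunction in
ONE kernel reduction, whose memory (the kernel caches every intermediate term) is capped on the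
farm (`lean --memory=12288`): measured 2026-08-16, about 60–90 s worth of exact `ℚ` arithmetic,
e.g. a rounded Gram certificate (`PSD.IsGramCertDD`) of size `30` but not `35`
("(kernel) excessive memory consumption", reported by `decide` as "failed to reduce"). Separate
`decide +kernel` calls start with an empty cache, so the remedy is to prove `∀ i, P i` block by
block. `forall_fin_of_blocks b` reduces `∀ i : Fin n, P i` to
`∀ c : Fin ((n + b - 1) / b), ∀ i : Fin n, b * c ≤ i < b * (c + 1) → P i`; after `intro c;
fin_cases c` every block is its own `decide +kernel` (the guards are evaluated first, so only the
block's rows are computed). `and_intro₃`-style packaging is left to the `.intro` lemmas of the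
individual predicates.

Usage:
```
theorem bigCert : PSD.IsGramCertDD A d B :=
  PSD.IsGramCertDD.intro (by decide +kernel)            -- d ≥ 0
    (PSD.IsDiagDominant.intro
      (forall_fin_of_blocks 10 (by norm_num) (by intro c; fin_cases c <;> decide +kernel))
      (forall_fin_of_blocks 10 (by norm_num) (by intro c; fin_cases c <;> decide +kernel)))
```

[folklore] throughout.
-/

namespace Literature.Computation.Certificates

/-- The block index of `i < n` is below the number of blocks `⌈n / b⌉ = (n + b - 1) / b`.
[folklore] -/
theorem div_lt_blocks {n b i : ℕ} (hb : 0 < b) (hi : i < n) : i / b < (n + b - 1) / b := by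
  have hn : 1 ≤ n := Nat.lt_of_le_of_lt (Nat.zero_le i) hi
  have h1 : (n + b - 1) / b = (n - 1) / b + 1 := by
    rw [show n + b - 1 = (n - 1) + b by omega, Nat.add_div_right _ hb]
  rw [h1, Nat.lt_succ_iff]
  exact Nat.div_le_div_right (by omega)

/-- **Block decomposition of a `Fin`-indexed universal statement.** To prove `∀ i : Fin n, P i`
it suffices to prove, for each of the `(n + b - 1) / b` blocks `c`, the guarded statement
`∀ i, b * c ≤ i.val → i.val < b * (c + 1) → P i` (each meant to be its own `decide +kernel`
after `intro c; fin_cases c`). [folklore] -/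
theorem forall_fin_of_blocks (b : ℕ) (hb : 0 < b) {n : ℕ} {P : Fin n → Prop}
    (h : ∀ c : Fin ((n + b - 1) / b), ∀ i : Fin n, b * c.val ≤ i.val → i.val < b * (c.val + 1) → P i) :
    ∀ i : Fin n, P i := fun i =>
  h ⟨i.val / b, div_lt_blocks hb i.isLt⟩ i (Nat.mul_div_le i.val b) (Nat.lt_mul_div_succ i.val hb)

/-- Two-way split at an index `k`: rows below `k` and rows from `k` on (for a quick halving).
[folklore] -/
theorem forall_fin_of_split (k : ℕ) {n : ℕ} {P : Fin n → Prop}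
    (h₁ : ∀ i : Fin n, i.val < k → P i) (h₂ : ∀ i : Fin n, k ≤ i.val → P i) : ∀ i : Fin n, P i :=
  fun i => (lt_or_ge i.val k).elim (h₁ i) (h₂ i)

/-! ### Tests (kernel-checked): the guards are decided first, block by block -/

/-- Test: a `Fin 10`-indexed rational statement proved in blocks of `4` (three blocks). -/
example : ∀ i : Fin 10, (0 : ℚ) ≤ ((i.val : ℚ) - 3) ^ 2 / 7 := by
  refine forall_fin_of_blocks 4 (by norm_num) ?_
  intro c
  fin_cases c <;> decide +kernel

/-- Test: the two-way split. -/
example : ∀ i : Fin 7, ∑ j : Fin i.val, ((j.val : ℚ) + 1) = (i.val : ℚ) * (i.val + 1) / 2 := by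
  refine forall_fin_of_split 4 ?_ ?_ <;> decide +kernel

end Literature.Computation.Certificates
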